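import Mathlib
import Literature.Combinatorics.Extremal.LinesThroughPointOfSurface
import Summits.ValiantsHypothesis.ValiantsHypothesis.Theorems.GrenetZeonTwoDimCoefficientsDefs
import Summits.ValiantsHypothesis.ValiantsHypothesis.Theorems.GrenetZeonTwoDimCoefficientsPermanentFlatSharp
import Literature.LinearAlgebra.Matrix.PermanentLaplace
import Summits.ValiantsHypothesis.ValiantsHypothesis.Theorems.GrenetZeonTwoDimCoefficientsDualUnipotentConstrainedPencil

/-!
# Crux `GrenetZeon.TwoDimCoefficients` (stmt-ValiantsHypothesis-8062), stub `stub_dualUnipotent`: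
# `DualUnipotentRepr n m` is ANTITONE in `n` (sub-permanents inherit representations)

The two-parameter predicate `DualUnipotentRepr n m` (`per_n = α·det A + β·tr(adj A·B)`, `A`, `B`
affine `m × m`, `det A ≡ c ≠ 0`) is transported along every affine algebra map that sends
`per_{n'}` to `per_n` (`dualUnipotentRepr_transport`: `det`, `adj`, `tr` commute with ring maps,
affine substitutions keep entries affine).  The substitution `x ↦ diag(1, x)` (first row and column
of the `(n+1) × (n+1)` matrix frozen to `e₀`; Laplace expansion along row `0`,
`Matrix.permanent_eq_sum_row_zero`)
sends `per_{n+1}` to `per_n`, so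

* `dualUnipotentRepr_of_succ` / `dualUnipotentRepr_anti` — `DualUnipotentRepr n' m → n ≤ n' →
  DualUnipotentRepr n m`: the minimal unipotent-dual width `m_DU(n)` is MONOTONE in `n`;
* `not_dualUnipotentRepr_mono` — impossibility results climb: with the tree's
  `not_dualUnipotentRepr_four_five` / `…_five_six` (`…PermanentFlatSharp`), NO `per_n` with `n ≥ 4`
  has a unipotent dual representation of size `5`, none with `n ≥ 5` one of size `6`
  (`not_dualUnipotentRepr_five_of_four_le`, `not_dualUnipotentRepr_six_of_five_le`).
* §3 (appended) `dualUnipotentRepr_succ_right` / `dualUnipotentRepr_mono_right` — MONOTONE in `m`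
  (`n ≥ 1`): pad the constrained nilpotent pencil (`…ConstrainedPencil`) by a zero row and column,
  `N ⊕ 0`, `M ⊕ 0`; so the feasible region `{(n, m) : DualUnipotentRepr n m}` is a down-set in `n`
  and an up-set in `m`, and every census point propagates both ways (`not_dualUnipotentRepr_of_le`).

HONEST FRAMING: bookkeeping on the shape of the predicate (it makes every census statement
`¬ DualUnipotentRepr n₀ m₀` valid for all `n ≥ n₀`); the stub `DualUnipotentBound` stays
open-problem grade; the crux (an ASIDE item) and `VP ≠ VNP` are not moved by anything here.

References: T. Mignon, N. Ressayre, Int. Math. Res. Not. 2004:79 (the model); L. G. Valiant,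
STOC 1979 (projections of the permanent).
-/

-- single-conjunct layout `Summits/ValiantsHypothesis/ValiantsHypothesis`: the duplicated namespace
-- component is mandated by the tree.
set_option linter.dupNamespace false

noncomputable section

namespace Summit.ValiantsHypothesis.ValiantsHypothesis.Cruxes.TwoDimCoefficients.DimTwoCases

open Literature.Computability.AlgebraicComplexity Matrix MvPolynomial
open Literature.Combinatorics.Extremal (totalDegree_aeval_le_of_le_one)

/-! ### Transport along affine algebra maps -/

section Transport

variable {n n' m : ℕ}

/-- **Transport.** If an algebra map `φ : ℂ[x_{n'×n'}] → ℂ[x_{n×n}]` keeps affine polynomials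
affine and sends `per_{n'}` to `per_n`, then it carries every unipotent dual representation of
`per_{n'}` of size `m` to one of `per_n` of the same size (`det`, `adj`, `tr` commute with `φ`;
`det A = c` is preserved because `φ` fixes constants). [folklore] -/
theorem dualUnipotentRepr_transport
    (φ : MvPolynomial (Fin n' × Fin n') ℂ →ₐ[ℂ] MvPolynomial (Fin n × Fin n) ℂ)
    (hφ : ∀ p : MvPolynomial (Fin n' × Fin n') ℂ, p.totalDegree ≤ 1 → (φ p).totalDegree ≤ 1)
    (hper : φ (perPoly (Fin n') ℂ) = perPoly (Fin n) ℂ) :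
    DualUnipotentRepr n' m → DualUnipotentRepr n m := by
  rintro ⟨α, β, c, A, B, hA, hB, hc, hdet, hrep⟩
  have hC : ∀ a : ℂ, φ (C a) = C a := fun a => by
    simpa only [MvPolynomial.algebraMap_eq] using φ.commutes a
  refine ⟨α, β, c, φ.mapMatrix A, φ.mapMatrix B, ?_, ?_, hc, ?_, ?_⟩
  · intro i j
    rw [AlgHom.mapMatrix_apply, Matrix.map_apply]
    exact hφ _ (hA i j)
  · intro i j
    rw [AlgHom.mapMatrix_apply, Matrix.map_apply]
    exact hφ _ (hB i j)
  · rw [← AlgHom.map_det, hdet, hC]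
  · have h := congrArg φ hrep
    rw [hper, map_add, map_mul, map_mul, hC, hC, AlgHom.map_det, AddMonoidHom.map_trace,
      ← AlgHom.mapMatrix_apply, map_mul, AlgHom.map_adjugate] at h
    exact h

end Transport

/-! ### The substitution `x ↦ diag(1, x)` and antitonicity in `n` -/

section Succ

variable {n m : ℕ}

/-- **`per_{n+1}` projects onto `per_n`** under any substitution `a` with `a (0,0) = 1`,
`a (0, c+1) = 0` and `a (r+1, c+1) = X (r, c)` (Laplace expansion along row `0`,
`Matrix.permanent_eq_sum_row_zero`; cf. the tree's column version `aeval_perPoly_succ` in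
`…DetQPDetqpThesisStubDeletion`, not imported here). [folklore] -/
theorem aeval_perPoly_succ_row {k : Type*} [CommSemiring k]
    (a : Fin (n + 1) × Fin (n + 1) → MvPolynomial (Fin n × Fin n) k) (h00 : a (0, 0) = 1)
    (h0s : ∀ c : Fin n, a (0, c.succ) = 0) (hss : ∀ r c : Fin n, a (r.succ, c.succ) = X (r, c)) :
    aeval a (perPoly (Fin (n + 1)) k) = perPoly (Fin n) k := by
  have h : aeval a (perPoly (Fin (n + 1)) k) = (Matrix.of fun i c => a (i, c)).permanent := by
    simp [perPoly, Matrix.permanent, map_sum, map_prod, Matrix.mvPolynomialX]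
  have hsub : (Matrix.of fun i c => a (i, c)).submatrix Fin.succ (0 : Fin (n + 1)).succAbove =
      Matrix.mvPolynomialX (Fin n) (Fin n) k := by
    ext r c
    simp [Matrix.mvPolynomialX_apply, Fin.succAbove_zero, hss]
  rw [h, Matrix.permanent_eq_sum_row_zero, Fin.sum_univ_succ, hsub]
  simp only [Matrix.of_apply, h00, h0s, zero_mul, Finset.sum_const_zero, add_zero, one_mul]
  rfl

/-- **`per_{n+1}` specialises to `per_n` inside the model:** a unipotent dual representation of
`per_{n+1}` of size `m` restricts (freeze row `0` and column `0` of the variable matrix to `e₀`)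
to one of `per_n` of the same size. [folklore] -/
theorem dualUnipotentRepr_of_succ (h : DualUnipotentRepr (n + 1) m) : DualUnipotentRepr n m := by
  -- the substitution: `x_{0,0} ↦ 1`, rest of row/column `0 ↦ 0`, `x_{r+1,c+1} ↦ x_{r,c}`
  let a : Fin (n + 1) × Fin (n + 1) → MvPolynomial (Fin n × Fin n) ℂ := fun e =>
    Fin.cases (motive := fun _ => MvPolynomial (Fin n × Fin n) ℂ)
      (Fin.cases (motive := fun _ => MvPolynomial (Fin n × Fin n) ℂ) 1 (fun _ => 0) e.2)
      (fun r => Fin.cases (motive := fun _ => MvPolynomial (Fin n × Fin n) ℂ) 0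
        (fun c => X (r, c)) e.2) e.1
  have h00 : a (0, 0) = 1 := by simp [a]
  have hs0 : ∀ r : Fin n, a (r.succ, 0) = 0 := fun r => by simp [a]
  have h0s : ∀ c : Fin n, a (0, c.succ) = 0 := fun c => by simp [a]
  have hss : ∀ r c : Fin n, a (r.succ, c.succ) = X (r, c) := fun r c => by simp [a]
  have hdeg : ∀ e, (a e).totalDegree ≤ 1 := by
    rintro ⟨i, c⟩
    refine Fin.cases ?_ (fun r => ?_) i <;> refine Fin.cases ?_ (fun c' => ?_) c
    · rw [h00, totalDegree_one]; exact Nat.zero_le _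
    · rw [h0s, totalDegree_zero]; exact Nat.zero_le _
    · rw [hs0, totalDegree_zero]; exact Nat.zero_le _
    · rw [hss, totalDegree_X]
  refine dualUnipotentRepr_transport (aeval a) (fun p hp => ?_) ?_ h
  · exact (totalDegree_aeval_le_of_le_one a hdeg p).trans hp
  · exact aeval_perPoly_succ_row a h00 h0s hss

/-- **Antitone in `n`.** `DualUnipotentRepr n' m → DualUnipotentRepr n m` for `n ≤ n'`: the
minimal width of a unipotent dual representation of `per_n` is monotone in `n`. [folklore] -/
theorem dualUnipotentRepr_anti {n n' m : ℕ} (hle : n ≤ n') (h : DualUnipotentRepr n' m) :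
    DualUnipotentRepr n m := by
  obtain ⟨k, rfl⟩ := Nat.exists_eq_add_of_le hle
  induction k with
  | zero => exact h
  | succ k ih => exact ih (Nat.le_add_right n k) (dualUnipotentRepr_of_succ h)

/-- **Impossibility climbs in `n`.** `¬ DualUnipotentRepr n₀ m → n₀ ≤ n → ¬ DualUnipotentRepr n m`.
[folklore] -/
theorem not_dualUnipotentRepr_mono {n₀ n m : ℕ} (h : ¬ DualUnipotentRepr n₀ m) (hle : n₀ ≤ n) :
    ¬ DualUnipotentRepr n m :=
  fun h' => h (dualUnipotentRepr_anti hle h')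

/-- No `per_n` with `n ≥ 4` has a unipotent dual representation of size `5`
(`not_dualUnipotentRepr_four_five`, climbed). [folklore] -/
theorem not_dualUnipotentRepr_five_of_four_le {n : ℕ} (hn : 4 ≤ n) : ¬ DualUnipotentRepr n 5 :=
  not_dualUnipotentRepr_mono not_dualUnipotentRepr_four_five hn

/-- No `per_n` with `n ≥ 5` has a unipotent dual representation of size `6`
(`not_dualUnipotentRepr_five_six`, climbed). [folklore] -/
theorem not_dualUnipotentRepr_six_of_five_le {n : ℕ} (hn : 5 ≤ n) : ¬ DualUnipotentRepr n 6 :=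
  not_dualUnipotentRepr_mono not_dualUnipotentRepr_five_six hn

end Succ

/-! ### §3 Monotone in `m`: padding the constrained pencil by a zero row and column -/

section Pad

variable {n m : ℕ}

/-- The trace of a block matrix is the sum of the traces of its diagonal blocks. [folklore] -/
theorem trace_fromBlocks' {R : Type*} [AddCommMonoid R] {p q : Type*} [Fintype p] [Fintype q]
    (A : Matrix p p R) (B : Matrix p q R) (C : Matrix q p R) (D : Matrix q q R) :
    (Matrix.fromBlocks A B C D).trace = A.trace + D.trace := by
  simp [Matrix.trace, Fintype.sum_sum_type]

/-- Powers of a zero-padded matrix act on the block: `(N ⊕ 0)^j · (M ⊕ 0) = (N^j·M) ⊕ 0`.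
[folklore] -/
theorem fromBlocks_pad_pow_mul {R : Type*} [CommRing R] {p q : Type*} [Fintype p] [Fintype q]
    [DecidableEq p] [DecidableEq q] (N M : Matrix p p R) (j : ℕ) :
    (Matrix.fromBlocks N 0 0 (0 : Matrix q q R)) ^ j * Matrix.fromBlocks M 0 0 (0 : Matrix q q R) =
      Matrix.fromBlocks (N ^ j * M) 0 0 (0 : Matrix q q R) := by
  induction j with
  | zero => rw [pow_zero, pow_zero, one_mul, one_mul]
  | succ j ih =>
    rw [pow_succ', mul_assoc, ih, Matrix.fromBlocks_multiply, pow_succ', mul_assoc]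
    simp

/-- The zero-padded power vanishes one step later: `(N ⊕ 0)^(j+1) = N^(j+1) ⊕ 0`. [folklore] -/
theorem fromBlocks_pad_pow_succ {R : Type*} [CommRing R] {p q : Type*} [Fintype p] [Fintype q]
    [DecidableEq p] [DecidableEq q] (N : Matrix p p R) (j : ℕ) :
    (Matrix.fromBlocks N 0 0 (0 : Matrix q q R)) ^ (j + 1) =
      Matrix.fromBlocks (N ^ (j + 1)) 0 0 (0 : Matrix q q R) := by
  induction j with
  | zero => rw [zero_add, pow_one, pow_one]
  | succ j ih =>
    rw [pow_succ, ih, Matrix.fromBlocks_multiply]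
    simp [pow_succ]

/-- **Monotone in `m` (one step).**  `DualUnipotentRepr n m → DualUnipotentRepr n (m + 1)` for
`n ≥ 1`: pad the constrained nilpotent linear pencil `(N, M)` of
`dualUnipotentRepr_iff_constrainedPencil` to `(N ⊕ 0, M ⊕ 0)` (still linear, `(N ⊕ 0)^{m+1} = 0`,
same traces `tr((N ⊕ 0)^j (M ⊕ 0)) = tr(N^j M)`). [folklore] -/
theorem dualUnipotentRepr_succ_right (hn : 1 ≤ n) (h : DualUnipotentRepr n m) :
    DualUnipotentRepr n (m + 1) := by
  obtain ⟨N, M, hN, hM, hnil, hper, hcon⟩ := (dualUnipotentRepr_iff_constrainedPencil hn).1 h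
  -- the padded pencil, reindexed to `Fin (m + 1)`
  let e : Fin m ⊕ Fin 1 ≃ Fin (m + 1) := finSumFinEquiv
  let φ := Matrix.reindexAlgEquiv ℂ (MvPolynomial (Fin n × Fin n) ℂ) e
  let N₀ : Matrix (Fin m ⊕ Fin 1) (Fin m ⊕ Fin 1) (MvPolynomial (Fin n × Fin n) ℂ) :=
    Matrix.fromBlocks N 0 0 0
  let M₀ : Matrix (Fin m ⊕ Fin 1) (Fin m ⊕ Fin 1) (MvPolynomial (Fin n × Fin n) ℂ) :=
    Matrix.fromBlocks M 0 0 0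
  have hlin : ∀ (P : AffMat n m), (∀ i j, (P i j).IsHomogeneous 1) →
      ∀ i j, ((φ (Matrix.fromBlocks P 0 0 0)) i j).IsHomogeneous 1 := by
    intro P hP i j
    rw [Matrix.coe_reindexAlgEquiv, Matrix.reindex_apply, Matrix.submatrix_apply]
    rcases e.symm i with a | a <;> rcases e.symm j with b | b
    · simpa using hP a b
    · simpa using isHomogeneous_zero (Fin n × Fin n) ℂ 1
    · simpa using isHomogeneous_zero (Fin n × Fin n) ℂ 1
    · simpa using isHomogeneous_zero (Fin n × Fin n) ℂ 1
  have htr : ∀ j : ℕ, ((φ N₀) ^ j * φ M₀).trace = (N ^ j * M).trace := by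
    intro j
    rw [← map_pow, ← map_mul, fromBlocks_pad_pow_mul, Matrix.coe_reindexAlgEquiv,
      trace_reindex_self, trace_fromBlocks', Matrix.trace_zero, add_zero]
  refine (dualUnipotentRepr_iff_constrainedPencil hn).2 ⟨φ N₀, φ M₀, hlin N hN, hlin M hM, ?_, ?_, ?_⟩
  · rw [← map_pow, fromBlocks_pad_pow_succ, pow_succ, hnil, zero_mul, Matrix.fromBlocks_zero,
      map_zero]
  · rw [htr, hper]
  · intro j hj
    rw [htr, hcon j hj]

/-- **Monotone in `m`.** `DualUnipotentRepr n m → m ≤ m' → DualUnipotentRepr n m'` (`n ≥ 1`).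
[folklore] -/
theorem dualUnipotentRepr_mono_right {m' : ℕ} (hn : 1 ≤ n) (hle : m ≤ m')
    (h : DualUnipotentRepr n m) : DualUnipotentRepr n m' := by
  obtain ⟨k, rfl⟩ := Nat.exists_eq_add_of_le hle
  induction k with
  | zero => exact h
  | succ k ih => exact dualUnipotentRepr_succ_right hn (ih (Nat.le_add_right m k))

/-- **Census points propagate both ways:** `¬ DualUnipotentRepr n₀ m₀`, `n₀ ≤ n`, `m ≤ m₀`,
`n₀ ≥ 1` ⟹ `¬ DualUnipotentRepr n m`. [folklore] -/
theorem not_dualUnipotentRepr_of_le {n₀ m₀ n m : ℕ} (hn₀ : 1 ≤ n₀) (h : ¬ DualUnipotentRepr n₀ m₀)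
    (hn : n₀ ≤ n) (hm : m ≤ m₀) : ¬ DualUnipotentRepr n m :=
  fun h' => h (dualUnipotentRepr_mono_right hn₀ hm (dualUnipotentRepr_anti hn h'))

/-- `per_n` with `n ≥ 5` has no unipotent dual representation of ANY size `m ≤ 6`
(`not_dualUnipotentRepr_five_six`, propagated). [folklore] -/
theorem not_dualUnipotentRepr_of_five_le_of_le_six {n m : ℕ} (hn : 5 ≤ n) (hm : m ≤ 6) :
    ¬ DualUnipotentRepr n m :=
  not_dualUnipotentRepr_of_le (by norm_num) not_dualUnipotentRepr_five_six hn hm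

end Pad

end Summit.ValiantsHypothesis.ValiantsHypothesis.Cruxes.TwoDimCoefficients.DimTwoCases

end
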